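import Mathlib.Tactic
import HarnessLib

/-!
# Kozma–Nitzan's Question 8 — UB(δ) at the second class: the exact reduction and LEMMA Ψ₁⁰ (transparent root) (gen 44)

Support file (`--supports stmt-CriticalPhenomena-4575`, closed crux; independent mathematics on Kozma–Nitzan's Question 8,
arXiv:2401.12397 §5.5 p. 36), prover `prim-ineq-gen-6` (gen 44).  No definitions, no named facts, no sorries; standard axioms.
Memo `run/shared/lean/prim/prim-ineq-gen-6/PROOF-PSIVIS-G44.md` §5 (UB(δ): reductions, LEMMA Ψ₁⁰).

UB(δ)_j is the two-level subtree bound `δ_j ≤ c·μ̂^_j` (THEOREM UB, gen 28, is `U_j ≤ c·μ̂^_j`; LEMMA Ψ₀, gen 43, is the leaf case).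
Since `δ_j = U_j + w_j⁻` (gen 27) it is EQUIVALENT to `w_j⁻ ≤ cμ̂^_j − U_j`, and by THEOREM UB2 (`U_j ≤ cμ̂^_j − s_{j+1}Kc_j`) it
FOLLOWS from CONJECTURE W0 `w_j⁻ ≤ s_{j+1}·Kc_j` (the K-c slack of depth `j` pays the level-1 deficit of class `j`; `j = 0` is LEMMA Ψ₀);
by the δ-recursion `δ_j = max(U_j, ψ_j + Σ_{i<j} r_{i,j}δ_i)` it also follows, inductively, from CONJECTURE Ψ_j `δ_j > 0 ⟹ ψ_j ≤ cμ̂_j`.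
* `kUBd_of_W0` — `U ≤ cμ̂^ − sKc`, `w⁻ ≤ sKc`, `δ = U + w⁻` give `δ ≤ cμ̂^`;
* `kUBd_step_of_Psi` — the inductive step: `U_j ≤ cμ̂^_j`, `ψ_j ≤ cμ̂_j`, children `δ_i ≤ cμ̂^_i` (`r ≥ 0`), `μ̂^_j = μ̂_j + Σ r μ̂^_i` give
  `max(U_j, ψ_j + Σ rδ_i) ≤ cμ̂^_j`;
* `kPsi1_transparent_c_le` — transparent root (`A₀ = C₀ = 1`): the block relation `c·p₀ = s v₁·(p₀ s u₁ − m(1−p₀))` gives `c ≤ s²u₁v₁`;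
* `kPsi1_transparent` — LEMMA Ψ₁⁰: for a transparent root, `ψ₁ ≤ c·μ̂₁` UNCONDITIONALLY (sharp: sup `ψ₁/(cμ̂₁) = 1⁻`), in the two-step
  model `b₀ –s– b₁(A,C) –t– T₂(u₂,v₂,m₂)`: `ψ₁ − cμ̂₁ = c p₁ n₁ − AC·W₁`, `n₁ = A(1−C) + C(1−A)`,
  `W₁ = (Φ+m)(p₁−p₀) + DΦ(1−p₁)`, and `c p₁ n₁ ≤ s²u₁v₁p₁n₁ = AC·s²p₁{(u₁+v₁)(1−A)(1−C)m̃ + v₁t(1−C)u₂ + u₁t(1−A)v₂} ≤ AC(Φ+m)(p₁−p₀)`.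
[cite: KozmaNitzan2024, Question 8 (§5.5 p. 36)]
-/

namespace Summit.CriticalPhenomena.PercolationContinuityZ3.Theorems

namespace PocketCert

/-- **UB(δ) from W0.**  If `U ≤ cμ̂^ − s·Kc` (THEOREM UB2), `w⁻ ≤ s·Kc` (W0) and `δ = U + w⁻`, then `δ ≤ cμ̂^`.
[cite: KozmaNitzan2024, Question 8 (§5.5 p. 36)] -/
theorem kUBd_of_W0 (U δ wm sKc cmuh : ℝ) (hUB2 : U ≤ cmuh - sKc) (hW0 : wm ≤ sKc) (hδ : δ = U + wm) :
    δ ≤ cmuh := by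
  rw [hδ]; linarith

open Finset in
/-- **UB(δ), inductive step from Ψ_j.**  With `δ_j = max(U_j, ψ_j + Σ_{i<j} r_i δ_i)`, `U_j ≤ c·μ̂^_j` (THEOREM UB), `ψ_j ≤ c·μ̂_j` (Ψ_j),
the children bounds `δ_i ≤ c·μ̂^_i` with `r_i ≥ 0`, and `μ̂^_j = μ̂_j + Σ r_i μ̂^_i`: `δ_j ≤ c·μ̂^_j`.
[cite: KozmaNitzan2024, Question 8 (§5.5 p. 36)] -/
theorem kUBd_step_of_Psi (j : ℕ) (r δc muhc : ℕ → ℝ) (U ψ δj muj muhj c : ℝ)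
    (hδj : δj = max U (ψ + ∑ i ∈ range j, r i * δc i)) (hU : U ≤ c * muhj) (hψ : ψ ≤ c * muj)
    (hr : ∀ i < j, 0 ≤ r i) (hch : ∀ i < j, δc i ≤ c * muhc i) (hmuh : muhj = muj + ∑ i ∈ range j, r i * muhc i) :
    δj ≤ c * muhj := by
  rw [hδj]
  apply max_le hU
  have h1 : ∑ i ∈ range j, r i * δc i ≤ ∑ i ∈ range j, r i * (c * muhc i) := by
    apply sum_le_sum; intro i hi
    exact mul_le_mul_of_nonneg_left (hch i (mem_range.mp hi)) (hr i (mem_range.mp hi))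
  have h2 : ∑ i ∈ range j, r i * (c * muhc i) = c * ∑ i ∈ range j, r i * muhc i := by
    rw [mul_sum]; apply sum_congr rfl; intro i _; ring
  rw [hmuh, mul_add]; linarith

/-- **Transparent root: `c ≤ s²u₁v₁`.**  With `p₀ > 0`, `m ≥ 0`, `p₀ ≤ 1`, `s, u₁, v₁ ≥ 0` and the block relation
`c·p₀ = s v₁ (p₀ s u₁ − m(1−p₀))` (`cΦ = Dϖ` with `Φ = p₀`, `D = s v₁`, `ϖ = Φ s u₁ − m(1−Φ)`): `c ≤ s² u₁ v₁`.
[cite: KozmaNitzan2024, Question 8 (§5.5 p. 36)] -/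
theorem kPsi1_transparent_c_le (c p0 s u1 v1 m : ℝ) (hp : 0 < p0) (hp1 : p0 ≤ 1) (hm : 0 ≤ m) (hs : 0 ≤ s)
    (hv : 0 ≤ v1) (hc : c * p0 = s * v1 * (p0 * s * u1 - m * (1 - p0))) :
    c ≤ s ^ 2 * u1 * v1 := by
  have h1 : c * p0 ≤ (s ^ 2 * u1 * v1) * p0 := by
    rw [hc]
    have e : s * v1 * (p0 * s * u1 - m * (1 - p0)) = (s ^ 2 * u1 * v1) * p0 - s * v1 * m * (1 - p0) := by ring
    rw [e]
    have : 0 ≤ s * v1 * m * (1 - p0) := mul_nonneg (mul_nonneg (mul_nonneg hs hv) hm) (by linarith)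
    linarith
  exact le_of_mul_le_mul_right h1 hp

/-- **LEMMA Ψ₁⁰, identity 1:** `ψ₁ − c p₁AC = c p₁ n₁ − AC·W₁` with `n₁ = A(1−C)+C(1−A)`, `W₁ = (p₀+m)(p₁−p₀) + s v₁ p₀(1−p₁)`
(transparent root: `Φ = p₀`, `D = s v₁`, `π = p₀ − s v₁`, `σ = π + m`, `K₄ = (Φ+m)(1−Φ)`).  [cite: KozmaNitzan2024, Question 8 (§5.5 p. 36)] -/
theorem kPsi1_transparent_id1 (s A C c p1 p0 m v1 : ℝ) :
    (c * p1 * (A + C - 2 * A * C) + ((c - (p0 + m) * (1 - p0)) - p0 * ((p0 - s * v1) + m)) * p1 * A * C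
        + p0 * ((p0 - s * v1) + m) * A * C) - c * p1 * A * C
      = c * p1 * (A * (1 - C) + C * (1 - A)) - A * C * ((p0 + m) * (p1 - p0) + s * v1 * p0 * (1 - p1)) := by
  ring

/-- **LEMMA Ψ₁⁰, identity 2 (the increment):** `p₁ − p₀ = (1−A)(1−C)m̃ + t(1−A)v₂ + t(1−C)u₂`.
[cite: KozmaNitzan2024, Question 8 (§5.5 p. 36)] -/
theorem kPsi1_transparent_id2 (A C t u2 v2 m2 p1 mt u1 v1 m1 p0 : ℝ) (hp1 : p1 = u2 + v2 + m2)
    (hmt : mt = (1 - t) * p1 + t * m2) (hu1 : u1 = C * (1 - A) * mt + t * C * u2) (hv1 : v1 = A * (1 - C) * mt + t * A * v2)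
    (hm1 : m1 = A * C * mt) (hp0 : p0 = u1 + v1 + m1) :
    p1 - p0 = (1 - A) * (1 - C) * mt + t * (1 - A) * v2 + t * (1 - C) * u2 := by
  subst hp0 hm1 hv1 hu1
  rw [hmt, hp1]; ring

/-- **LEMMA Ψ₁⁰, identity 3 (the regrouping):** `u₁v₁·n₁ = AC·{(u₁+v₁)(1−A)(1−C)m̃ + v₁t(1−C)u₂ + u₁t(1−A)v₂}`.
[cite: KozmaNitzan2024, Question 8 (§5.5 p. 36)] -/
theorem kPsi1_transparent_id3 (A C t u2 v2 mt u1 v1 : ℝ)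
    (hu1 : u1 = C * (1 - A) * mt + t * C * u2) (hv1 : v1 = A * (1 - C) * mt + t * A * v2) :
    u1 * v1 * (A * (1 - C) + C * (1 - A))
      = A * C * ((u1 + v1) * ((1 - A) * (1 - C) * mt) + v1 * (t * (1 - C) * u2) + u1 * (t * (1 - A) * v2)) := by
  subst hu1 hv1; ring

set_option maxHeartbeats 400000 in
/-- **LEMMA Ψ₁⁰ (transparent root).**  Two-step model `b₀ –s– b₁ –t– T₂` with `A₀ = C₀ = 1`, vertex-1 marks `0 ≤ A, C ≤ 1`,
`0 ≤ s, t ≤ 1`, suffix channels `u₂, v₂, m₂ ≥ 0`, `p₁ = u₂+v₂+m₂ ≤ 1`, `p₀ > 0`, and `c` with the block relation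
`c p₀ = s v₁ (p₀ s u₁ − m(1−p₀))`.  Then `ψ₁ ≤ c·μ̂₁ = c·p₁·A·C` — UB(δ) at class 1 needs no positivity hypothesis when the root
is transparent (sharp: sup `ψ₁/(cμ̂₁) = 1⁻`).  [cite: KozmaNitzan2024, Question 8 (§5.5 p. 36)] -/
theorem kPsi1_transparent (s A C t u2 v2 m2 c p1 mt u1 v1 m1 p0 m ψ1 : ℝ)
    (hp1 : p1 = u2 + v2 + m2) (hmt : mt = (1 - t) * p1 + t * m2) (hu1 : u1 = C * (1 - A) * mt + t * C * u2)
    (hv1 : v1 = A * (1 - C) * mt + t * A * v2) (hm1 : m1 = A * C * mt) (hp0 : p0 = u1 + v1 + m1) (hm : m = p0 - s * (u1 + v1))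
    (hψ : ψ1 = c * p1 * (A + C - 2 * A * C) + ((c - (p0 + m) * (1 - p0)) - p0 * ((p0 - s * v1) + m)) * p1 * A * C
        + p0 * ((p0 - s * v1) + m) * A * C)
    (hs0 : 0 ≤ s) (hs1 : s ≤ 1) (hA0 : 0 ≤ A) (hA1 : A ≤ 1) (hC0 : 0 ≤ C) (hC1 : C ≤ 1) (ht0 : 0 ≤ t) (ht1 : t ≤ 1)
    (hu : 0 ≤ u2) (hv : 0 ≤ v2) (hm2 : 0 ≤ m2) (hp1le : p1 ≤ 1) (hp0pos : 0 < p0)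
    (hc : c * p0 = s * v1 * (p0 * s * u1 - m * (1 - p0))) :
    ψ1 ≤ c * p1 * A * C := by
  -- signs
  have hAb : 0 ≤ 1 - A := by linarith
  have hCb : 0 ≤ 1 - C := by linarith
  have htb : 0 ≤ 1 - t := by linarith
  have hp1' : 0 ≤ p1 := by rw [hp1]; linarith
  have hmt0 : 0 ≤ mt := by rw [hmt]; exact add_nonneg (mul_nonneg htb hp1') (mul_nonneg ht0 hm2)
  have hX : 0 ≤ (1 - A) * mt + t * u2 := add_nonneg (mul_nonneg hAb hmt0) (mul_nonneg ht0 hu)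
  have hY : 0 ≤ (1 - C) * mt + t * v2 := add_nonneg (mul_nonneg hCb hmt0) (mul_nonneg ht0 hv)
  have hu1' : 0 ≤ u1 := by
    have e : u1 = C * ((1 - A) * mt + t * u2) := by rw [hu1]; ring
    rw [e]; exact mul_nonneg hC0 hX
  have hv1' : 0 ≤ v1 := by
    have e : v1 = A * ((1 - C) * mt + t * v2) := by rw [hv1]; ring
    rw [e]; exact mul_nonneg hA0 hY
  have hm1' : 0 ≤ m1 := by rw [hm1]; exact mul_nonneg (mul_nonneg hA0 hC0) hmt0
  -- the increment is ≥ 0, hence p0 ≤ p1 ≤ 1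
  have hinc := kPsi1_transparent_id2 A C t u2 v2 m2 p1 mt u1 v1 m1 p0 hp1 hmt hu1 hv1 hm1 hp0
  have hI1 : 0 ≤ (1 - A) * (1 - C) * mt := mul_nonneg (mul_nonneg hAb hCb) hmt0
  have hI2 : 0 ≤ t * (1 - C) * u2 := mul_nonneg (mul_nonneg ht0 hCb) hu
  have hI3 : 0 ≤ t * (1 - A) * v2 := mul_nonneg (mul_nonneg ht0 hAb) hv
  have hinc0 : 0 ≤ p1 - p0 := by rw [hinc]; linarith
  have hp0le : p0 ≤ 1 := by linarith
  have huv : u1 + v1 ≤ p0 := by rw [hp0]; linarith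
  have hsuv : s * (u1 + v1) ≤ u1 + v1 := mul_le_of_le_one_left (by linarith) hs1
  have hmm : 0 ≤ m := by rw [hm]; linarith
  -- c ≤ s² u1 v1
  have hcle : c ≤ s ^ 2 * u1 * v1 := kPsi1_transparent_c_le c p0 s u1 v1 m hp0pos hp0le hmm hs0 hv1' hc
  -- identity 1
  have hid : ψ1 - c * p1 * A * C
      = c * p1 * (A * (1 - C) + C * (1 - A)) - A * C * ((p0 + m) * (p1 - p0) + s * v1 * p0 * (1 - p1)) := by
    rw [hψ]; exact kPsi1_transparent_id1 s A C c p1 p0 m v1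
  have hn1 : 0 ≤ A * (1 - C) + C * (1 - A) := add_nonneg (mul_nonneg hA0 hCb) (mul_nonneg hC0 hAb)
  -- step 1: c p1 n1 ≤ s² u1 v1 p1 n1
  have h1 : c * p1 * (A * (1 - C) + C * (1 - A)) ≤ (s ^ 2 * u1 * v1) * (p1 * (A * (1 - C) + C * (1 - A))) := by
    have := mul_le_mul_of_nonneg_right hcle (mul_nonneg hp1' hn1)
    have e : c * p1 * (A * (1 - C) + C * (1 - A)) = c * (p1 * (A * (1 - C) + C * (1 - A))) := by ring
    rw [e]; exact this
  -- step 2: regroup and bound the brace by (u1+v1)(p1-p0)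
  have hkey := kPsi1_transparent_id3 A C t u2 v2 mt u1 v1 hu1 hv1
  have hbr : (u1 + v1) * ((1 - A) * (1 - C) * mt) + v1 * (t * (1 - C) * u2) + u1 * (t * (1 - A) * v2)
      ≤ (u1 + v1) * (p1 - p0) := by
    rw [hinc]
    have e1 : v1 * (t * (1 - C) * u2) ≤ (u1 + v1) * (t * (1 - C) * u2) :=
      mul_le_mul_of_nonneg_right (by linarith) hI2
    have e2 : u1 * (t * (1 - A) * v2) ≤ (u1 + v1) * (t * (1 - A) * v2) :=
      mul_le_mul_of_nonneg_right (by linarith) hI3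
    have e3 : (u1 + v1) * ((1 - A) * (1 - C) * mt + t * (1 - A) * v2 + t * (1 - C) * u2)
        = (u1 + v1) * ((1 - A) * (1 - C) * mt) + (u1 + v1) * (t * (1 - C) * u2) + (u1 + v1) * (t * (1 - A) * v2) := by ring
    rw [e3]; linarith
  -- step 3: s² p1 (u1+v1) ≤ p0 + m
  have hs2 : s ^ 2 * p1 ≤ 1 := by nlinarith
  have h3 : s ^ 2 * p1 * (u1 + v1) ≤ p0 + m := by
    have e1 : s ^ 2 * p1 * (u1 + v1) ≤ 1 * (u1 + v1) := mul_le_mul_of_nonneg_right hs2 (by linarith)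
    linarith
  -- combine
  have hAC : 0 ≤ A * C := mul_nonneg hA0 hC0
  have h4 : (s ^ 2 * u1 * v1) * (p1 * (A * (1 - C) + C * (1 - A))) ≤ A * C * ((p0 + m) * (p1 - p0)) := by
    have e1 : (s ^ 2 * u1 * v1) * (p1 * (A * (1 - C) + C * (1 - A)))
        = (s ^ 2 * p1) * (u1 * v1 * (A * (1 - C) + C * (1 - A))) := by ring
    rw [e1, hkey]
    have e2 : (s ^ 2 * p1) * (A * C * ((u1 + v1) * ((1 - A) * (1 - C) * mt) + v1 * (t * (1 - C) * u2) + u1 * (t * (1 - A) * v2)))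
        ≤ (s ^ 2 * p1) * (A * C * ((u1 + v1) * (p1 - p0))) :=
      mul_le_mul_of_nonneg_left (mul_le_mul_of_nonneg_left hbr hAC) (mul_nonneg (sq_nonneg s) hp1')
    have e3 : (s ^ 2 * p1) * (A * C * ((u1 + v1) * (p1 - p0))) = A * C * ((s ^ 2 * p1 * (u1 + v1)) * (p1 - p0)) := by ring
    have e4 : (s ^ 2 * p1 * (u1 + v1)) * (p1 - p0) ≤ (p0 + m) * (p1 - p0) := mul_le_mul_of_nonneg_right h3 hinc0
    have e5 := mul_le_mul_of_nonneg_left e4 hAC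
    linarith
  have h5 : 0 ≤ A * C * (s * v1 * p0 * (1 - p1)) :=
    mul_nonneg hAC (mul_nonneg (mul_nonneg (mul_nonneg hs0 hv1') hp0pos.le) (by linarith))
  have : ψ1 - c * p1 * A * C ≤ 0 := by
    rw [hid]
    have e : A * C * ((p0 + m) * (p1 - p0) + s * v1 * p0 * (1 - p1))
        = A * C * ((p0 + m) * (p1 - p0)) + A * C * (s * v1 * p0 * (1 - p1)) := by ring
    rw [e]; linarith
  linarith

end PocketCert

end Summit.CriticalPhenomena.PercolationContinuityZ3.Theorems
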